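import Summits.BirchSwinnertonDyer.BirchSwinnertonDyer.Theorems.ThetaPartnerAtTwoSignedControlAtTwoPlusLocalInjOfHonda
import HarnessLib

/-!
# COINV⁺ — the `Γ`-coinvariants of `(⋃ₙ E⁺(K_n·K_v)) ⊗ ℚ_p/ℤ_p` vanish, in pair form — from the SAME plus Honda system that
# gives CYC⁺/INJ⁺: the local residue LOC⁺@2 of K4 `SignedControlAtTwo` (stmt-BirchSwinnertonDyer-20309, line `eulerchar` v4,
# KIM⁺@2 side, seat w2) reduced to (HONDA⁺) as well, any `K`, `p`, `κ`, `ι`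

Seat `prover-bsd-wall-tp2-p3-w3` (width seat 3/3). Sequel of `…PlusCyclicOfHonda` (CYC⁺ ⟸ Honda system) and
`…PlusLocalInjOfHonda` (INJ⁺@2 ⟸ Honda system + LEV0@2). The `⁺` twin, for Kobayashi's trace-defined `E⁺`, of the ♭ road's
`SSFlatEC.flatAnnihilator_twist_divisible` (`(E♭_∞)_Γ = 0` in pair form, seat `bsd-2adic-ss-1` GEN 13), which is the module-level
input of the LOC♭ engine `SSFlatEC.exists_localLift_flat` (Greenberg LNM 1716 p. 108, `cd_p = 1` + Kummer plumbing).

WHAT (`M_n = E(K_n·K_v)`, `E⁺_n` Kobayashi's plus points, `g ∈ Γ_{K_v}` restricting to the topological generator of `Γ`; the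
Honda package (L) (TR) (GEN) (GEN₀) of `plusCyclic_of_honda`, (NT), (IDX)).
* §1 `pow_smul_sub_eq_smul_sub` (telescoping `gⁱQ − Q = gY − Y`), `localTraceOfEmb_eq_index_smul_add_twist`
  (**`Tr_{m+1/m} Q = [K_{m+1}·K_v : K_m·K_v]·Q + (gY − Y)`** with `Y` in the orbit span of `Q`: each coset representative acts as a
  power of `g`, `exists_lt_pow_inv_mul_mem_layerSubgroup`), `exists_eq_neg_localTraceOfEmb_of_mem_closure_orbit` (the orbit span of
  `d_n = −Tr d_{n+2}` is `−Tr` of the orbit span of `d_{n+2}`).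
* §2 **`plusLocOne_of_honda`**: `x ∈ E⁺_{2j} ⇒ x = (g y − y) + p z` with `y, z ∈ E⁺_{2j+2}` (CYC⁺ at `2j`, then `d_{2j} = −Tr d_{2j+2}`
  and `Tr = p + (g − 1)(…)`); **`plusDiv_of_honda`**: iterating, `x = (g y − y) + p^k z` with `y, z ∈ E⁺_{2j+2k}`;
  **`plusCoinvPair_of_honda`**: for `x ∈ ⨆ₙ E⁺_n` and `k`, some `x', m ∈ ⨆ₙ E⁺_n` with
  `p^k·x − p^k·(g⁻¹x' − x') = p^{2k}·m`, i.e. `x ⊗ p^{-k} = (g⁻¹ − 1)(x' ⊗ p^{-k})` in `M ⊗ ℚ_p/ℤ_p`: **`((⋃E⁺_n) ⊗ ℚ_p/ℤ_p)_Γ = 0`**.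
* §3 (`K = ℚ`, `p = 2`, cyclotomic `κ`, `v ∋ 2`) `plusCoinvPair_two_of_honda` — (NT) and (IDX) discharged
  (`SSFlatEC.eq_zero_of_mem_localTowerPointsOfEmb_of_two_nsmul`, `index_subgroupOf_localLayerSubgroupOfEmb_succ_eq`).

NET for K4: both READ-AT-2 residues of line `eulerchar` — INJ⁺@2 (`…PlusLocalInjOfHonda`) and the module-level core of LOC⁺@2 (this
file; the cohomological `cd = 1` plumbing to the lift statement is the `⁺` twin of `SSFlatEC.exists_localLift_flat`) — follow from
ONE local package: the plus Honda system at `2` with generation (HONDA⁺@2), plus the elementary LEV0@2.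

HONEST FRAMING: THEOREMS ONLY (no definition, no named fact, no `sorry`), route-independent; nothing about any curve is asserted
beyond the displayed hypotheses; closes no item; BSD is not proved by any of this.

References: [Kobayashi2003] §8.4 (Lemma 8.9, Prop. 8.11, Prop. 8.12), Thm. 6.2, Prop. 8.23; [Sprung2012] Def. 7.9, Lemma 7.10, Thm. 2.2;
[BDKim2013] Props. 2.2–2.3, proof of Cor. 3.15; [GreenbergLNM1716] §4 proof of Lemma 4.7 (p. 108); [Washington1997] §13.1.
-/

set_option autoImplicit false
-- the Theorems namespace of this sub repeats the summit name by design (D-0017 nested layout)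
set_option linter.dupNamespace false

noncomputable section

open scoped Classical NumberField

open Finset

namespace Summit.BirchSwinnertonDyer.BirchSwinnertonDyer.Theorems.SignedEC

open Literature.NumberTheory.EllipticCurves Literature.NumberTheory.GaloisRepresentations
  WeierstrassCurve ZpExtension Literature.NumberTheory.EllipticCurves.Kobayashi2003
  Literature.NumberTheory.EllipticCurves.Sprung2012 Summit.BirchSwinnertonDyer.Rank1Residual.Additive

universe u

section General

variable {K : Type u} [Field K] (W : WeierstrassCurve K) {p : ℕ} [Fact p.Prime] (κ : ZpExtension K p)
  {E : Type u} [Field E] [Algebra K E] (ι : AlgebraicClosure K →ₐ[K] AlgebraicClosure E)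

/-! ## §1 Traces are `index + (g − 1)(…)` -/

/-- Telescoping: `gⁱ • Q − Q = g • Y − Y` with `Y = ∑_{l<i} gˡ • Q`. [folklore] -/
theorem pow_smul_sub_eq_smul_sub (g : Field.absoluteGaloisGroup E) (Q : localPoints W E) (i : ℕ) :
    g ^ i • Q - Q = g • (∑ l ∈ range i, g ^ l • Q) - ∑ l ∈ range i, g ^ l • Q := by
  induction i with
  | zero => simp
  | succ i ih =>
    rw [sum_range_succ, smul_add, smul_smul, ← pow_succ']
    have e : g ^ (i + 1) • Q - Q = (g ^ (i + 1) • Q - g ^ i • Q) + (g ^ i • Q - Q) := by abel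
    rw [e, ih]
    abel

/-- The partial orbit sums lie in the orbit span. [folklore] -/
theorem sum_pow_smul_mem_closure_orbit (g : Field.absoluteGaloisGroup E) (Q : localPoints W E) (i : ℕ) :
    ∑ l ∈ range i, g ^ l • Q ∈ AddSubgroup.closure (Set.range fun σ : Field.absoluteGaloisGroup E ↦ σ • Q) :=
  sum_mem fun l _ ↦ AddSubgroup.subset_closure ⟨g ^ l, rfl⟩

/-- **`Tr_{m+1/m} Q = [K_{m+1}·K_v : K_m·K_v] · Q + (g • Y − Y)`** for `Q ∈ E(K_{m+1}·K_v)` and `g` restricting to a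
topological generator, with `Y` in the orbit span of `Q`: each coset representative of `Gal(K̄_v/K_m·K_v)/Gal(K̄_v/K_{m+1}·K_v)`
acts on `E(K_{m+1}·K_v)` as a power `gⁱ` (`exists_lt_pow_inv_mul_mem_layerSubgroup`), and `gⁱQ − Q = (g − 1)∑_{l<i} gˡQ`.
[cite: Kobayashi2003, §2 p. 4 (the trace map)] [cite: Washington1997, §13.1] -/
theorem localTraceOfEmb_eq_index_smul_add_twist {g : Field.absoluteGaloisGroup E} (hg : κ.IsTopGenerator (resGalOfEmb ι g))
    (m : ℕ) {Q : localPoints W E} (hQ : Q ∈ localLayerPointsOfEmb κ ι W (m + 1)) :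
    ∃ Y ∈ AddSubgroup.closure (Set.range fun σ : Field.absoluteGaloisGroup E ↦ σ • Q),
      localTraceOfEmb κ ι W m (m + 1) Q =
        ((localLayerSubgroupOfEmb κ ι (m + 1)).subgroupOf (localLayerSubgroupOfEmb κ ι m)).index • Q + (g • Y - Y) := by
  haveI : Fintype (localLayerSubgroupOfEmb κ ι m ⧸
      (localLayerSubgroupOfEmb κ ι (m + 1)).subgroupOf (localLayerSubgroupOfEmb κ ι m)) := Fintype.ofFinite _
  -- each representative acts as a power of `g`
  have hrep : ∀ q : localLayerSubgroupOfEmb κ ι m ⧸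
      (localLayerSubgroupOfEmb κ ι (m + 1)).subgroupOf (localLayerSubgroupOfEmb κ ι m),
      ∃ i : ℕ, ((q.out : localLayerSubgroupOfEmb κ ι m) : Field.absoluteGaloisGroup E) • Q = g ^ i • Q := by
    intro q
    obtain ⟨i, -, hi⟩ := FineSelmerLeSignedSelmer.exists_lt_pow_inv_mul_mem_layerSubgroup κ hg (m + 1)
      (resGalOfEmb ι ((q.out : localLayerSubgroupOfEmb κ ι m) : Field.absoluteGaloisGroup E))
    have hh : (g ^ i)⁻¹ * ((q.out : localLayerSubgroupOfEmb κ ι m) : Field.absoluteGaloisGroup E) ∈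
        localLayerSubgroupOfEmb κ ι (m + 1) := by
      change _ ∈ localSubgroupOfEmb (κ.layerSubgroup (m + 1)) ι
      rw [mem_localSubgroupOfEmb_iff, map_mul, map_inv, map_pow]
      exact hi
    refine ⟨i, ?_⟩
    have hfix := (mem_localLayerPointsOfEmb_iff κ ι W (m + 1) Q).1 hQ _ hh
    calc ((q.out : localLayerSubgroupOfEmb κ ι m) : Field.absoluteGaloisGroup E) • Q
        = (g ^ i * ((g ^ i)⁻¹ * ((q.out : localLayerSubgroupOfEmb κ ι m) : Field.absoluteGaloisGroup E))) • Q := by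
          rw [mul_inv_cancel_left]
      _ = g ^ i • Q := by rw [mul_smul, hfix]
  choose i hi using hrep
  refine ⟨∑ q, ∑ l ∈ range (i q), g ^ l • Q, sum_mem fun q _ ↦ sum_pow_smul_mem_closure_orbit W g Q (i q), ?_⟩
  rw [localTraceOfEmb_apply]
  have e : ∀ q, ((q.out : localLayerSubgroupOfEmb κ ι m) : Field.absoluteGaloisGroup E) • Q =
      Q + (g • (∑ l ∈ range (i q), g ^ l • Q) - ∑ l ∈ range (i q), g ^ l • Q) := fun q ↦ by
    rw [hi q, ← pow_smul_sub_eq_smul_sub]; abel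
  simp_rw [e]
  rw [sum_add_distrib, sum_const, card_univ, sum_sub_distrib, ← smul_sum, Subgroup.index, Nat.card_eq_fintype_card]

/-- The orbit span of `d_n = −Tr_{n+2/n+1} d_{n+2}` is `−Tr` of the orbit span of `d_{n+2}` (the trace commutes with `Γ_{K_v}`).
[cite: Kobayashi2003, Lemma 8.9, Prop. 8.12 i)] -/
theorem exists_eq_neg_localTraceOfEmb_of_mem_closure_orbit (n : ℕ) {d d' : localPoints W E}
    (hd : d ∈ localLayerPointsOfEmb κ ι W (n + 2)) (htr : localTraceOfEmb κ ι W (n + 1) (n + 2) d = -d')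
    {B : localPoints W E} (hB : B ∈ AddSubgroup.closure (Set.range fun σ : Field.absoluteGaloisGroup E ↦ σ • d')) :
    ∃ B' ∈ AddSubgroup.closure (Set.range fun σ : Field.absoluteGaloisGroup E ↦ σ • d),
      B = -localTraceOfEmb κ ι W (n + 1) (n + 2) B' := by
  induction hB using AddSubgroup.closure_induction with
  | mem y hy =>
    obtain ⟨σ, rfl⟩ := hy
    refine ⟨σ • d, AddSubgroup.subset_closure ⟨σ, rfl⟩, ?_⟩
    rw [Rank1Residual.Additive.localTraceOfEmb_eq_localPairTraceOfEmb,
      ← Rank1Residual.Additive.smul_localPairTraceOfEmb_of_normal ι W (κ.layerSubgroup (n + 1))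
        (κ.layerSubgroup (n + 2)) σ hd,
      ← Rank1Residual.Additive.localTraceOfEmb_eq_localPairTraceOfEmb, htr, smul_neg, neg_neg]
  | zero => exact ⟨0, AddSubgroup.zero_mem _, by rw [map_zero, neg_zero]⟩
  | add y z _ _ hy hz =>
    obtain ⟨B₁, hB₁, rfl⟩ := hy
    obtain ⟨B₂, hB₂, rfl⟩ := hz
    exact ⟨B₁ + B₂, AddSubgroup.add_mem _ hB₁ hB₂, by rw [map_add, neg_add]⟩
  | neg y _ hy =>
    obtain ⟨B₁, hB₁, rfl⟩ := hy
    exact ⟨-B₁, AddSubgroup.neg_mem _ hB₁, by rw [map_neg]⟩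

/-! ## §2 LOC1, DIV and the pair form of COINV⁺ from the Honda system -/

/-- **LOC1⁺**: under the Honda package, every `x ∈ E⁺(K_{2j}·K_v)` is `(g • y − y) + p • z` with `y, z ∈ E⁺(K_{2j+2}·K_v)`
(CYC⁺ at `2j`; `d_{2j} = −Tr d_{2j+2}`; `Tr = p + (g − 1)(…)`). [cite: Kobayashi2003, Prop. 8.12, Lemma 8.9] -/
theorem plusLocOne_of_honda
    (hnt : ∀ P ∈ localTowerPointsOfEmb κ ι W, p • P = 0 → P = 0)
    (hidx : ∀ m : ℕ, ((localLayerSubgroupOfEmb κ ι (m + 1)).subgroupOf (localLayerSubgroupOfEmb κ ι m)).index = p)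
    {g : Field.absoluteGaloisGroup E} (hg : κ.IsTopGenerator (resGalOfEmb ι g))
    (d : ℕ → localPoints W E) (hd : ∀ m, d m ∈ localLayerPointsOfEmb κ ι W m)
    (htr : ∀ m, localTraceOfEmb κ ι W (m + 1) (m + 2) (d (m + 2)) = -d m)
    (hgen : ∀ m : ℕ, 1 ≤ m → ∀ P ∈ localLayerPointsOfEmb κ ι W m,
      ∃ B ∈ AddSubgroup.closure (Set.range fun σ : Field.absoluteGaloisGroup E ↦ σ • d m),
        ∃ P' ∈ localLayerPointsOfEmb κ ι W (m - 1), ∃ R ∈ localLayerPointsOfEmb κ ι W m, P = B + P' + p • R)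
    (hgen0 : ∀ P ∈ localLayerPointsOfEmb κ ι W 0, ∃ a : ℤ, ∃ R ∈ localLayerPointsOfEmb κ ι W 0, P = a • d 0 + p • R) :
    ∀ j : ℕ, ∀ x ∈ signedLocalPointsOfEmb κ ι W 1 (2 * j),
      ∃ y ∈ signedLocalPointsOfEmb κ ι W 1 (2 * j + 2), ∃ z ∈ signedLocalPointsOfEmb κ ι W 1 (2 * j + 2),
        x = (g • y - y) + p • z := by
  intro j x hx
  have hmono : signedLocalPointsOfEmb κ ι W 1 (2 * j) ≤ signedLocalPointsOfEmb κ ι W 1 (2 * j + 2) :=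
    signedLocalPointsOfEmb_mono κ ι W 1 (by omega)
  have hdn : d (2 * j + 2) ∈ signedLocalPointsOfEmb κ ι W 1 (2 * j + 2) := by
    have := d_even_mem_signedLocalPointsOfEmb_one W κ ι d hd htr (j + 1)
    rwa [show 2 * (j + 1) = 2 * j + 2 by ring] at this
  have hclo_n := closure_orbit_le_signedLocalPointsOfEmb W κ ι 1 (2 * j + 2) hdn
  have hstab : ∀ (σ : Field.absoluteGaloisGroup E), ∀ a ∈ signedLocalPointsOfEmb κ ι W 1 (2 * j + 2),
      σ • a ∈ signedLocalPointsOfEmb κ ι W 1 (2 * j + 2) := by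
    intro σ a ha
    rw [signedLocalPointsOfEmb_eq_towerSigned] at ha ⊢
    exact smul_mem_towerSignedLocalPointsOfEmb κ.layerSubgroup ι W 1 (2 * j + 2) σ ha
  -- CYC⁺ at `2j`
  obtain ⟨B, hB, b, hb, hxe⟩ := plusCyclic_even_of_honda W κ ι hnt hidx d hd htr hgen hgen0 j x hx
  -- `B = -Tr B'`
  obtain ⟨B', hB', hBB'⟩ := exists_eq_neg_localTraceOfEmb_of_mem_closure_orbit W κ ι (2 * j) (hd (2 * j + 2)) (htr (2 * j)) hB
  have hB'M : B' ∈ localLayerPointsOfEmb κ ι W (2 * j + 2) := signedLocalPointsOfEmb_le κ ι W 1 _ (hclo_n hB')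
  -- `Tr B' = p • B' + (g • Y − Y)`
  obtain ⟨Y, hY, hTr⟩ := localTraceOfEmb_eq_index_smul_add_twist W κ ι hg (2 * j + 1) hB'M
  rw [hidx (2 * j + 1)] at hTr
  have hYplus : Y ∈ signedLocalPointsOfEmb κ ι W 1 (2 * j + 2) := hclo_n (closure_orbit_le_of_mem W (d (2 * j + 2)) hB' hY)
  refine ⟨-Y, AddSubgroup.neg_mem _ hYplus, b - B', sub_mem (hmono hb) (hclo_n hB'), ?_⟩
  rw [hxe, hBB', show 2 * j + 1 + 1 = 2 * j + 2 by ring] at *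
  rw [hTr, smul_neg, smul_sub]
  abel

/-- **DIV⁺**: under the Honda package, every `x ∈ E⁺(K_{2j}·K_v)` is `(g • y − y) + p^k • z` with `y, z ∈ E⁺(K_{2j+2k}·K_v)`,
for every `k` (iterate LOC1⁺). [cite: Kobayashi2003, Prop. 8.12, Thm. 6.2] -/
theorem plusDiv_of_honda
    (hnt : ∀ P ∈ localTowerPointsOfEmb κ ι W, p • P = 0 → P = 0)
    (hidx : ∀ m : ℕ, ((localLayerSubgroupOfEmb κ ι (m + 1)).subgroupOf (localLayerSubgroupOfEmb κ ι m)).index = p)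
    {g : Field.absoluteGaloisGroup E} (hg : κ.IsTopGenerator (resGalOfEmb ι g))
    (d : ℕ → localPoints W E) (hd : ∀ m, d m ∈ localLayerPointsOfEmb κ ι W m)
    (htr : ∀ m, localTraceOfEmb κ ι W (m + 1) (m + 2) (d (m + 2)) = -d m)
    (hgen : ∀ m : ℕ, 1 ≤ m → ∀ P ∈ localLayerPointsOfEmb κ ι W m,
      ∃ B ∈ AddSubgroup.closure (Set.range fun σ : Field.absoluteGaloisGroup E ↦ σ • d m),
        ∃ P' ∈ localLayerPointsOfEmb κ ι W (m - 1), ∃ R ∈ localLayerPointsOfEmb κ ι W m, P = B + P' + p • R)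
    (hgen0 : ∀ P ∈ localLayerPointsOfEmb κ ι W 0, ∃ a : ℤ, ∃ R ∈ localLayerPointsOfEmb κ ι W 0, P = a • d 0 + p • R) :
    ∀ k j : ℕ, ∀ x ∈ signedLocalPointsOfEmb κ ι W 1 (2 * j),
      ∃ y ∈ signedLocalPointsOfEmb κ ι W 1 (2 * j + 2 * k), ∃ z ∈ signedLocalPointsOfEmb κ ι W 1 (2 * j + 2 * k),
        x = (g • y - y) + p ^ k • z := by
  intro k
  induction k with
  | zero =>
    intro j x hx
    refine ⟨0, AddSubgroup.zero_mem _, x, by simpa using hx, ?_⟩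
    rw [smul_zero, sub_zero, zero_add, pow_zero, one_smul]
  | succ k ih =>
    intro j x hx
    obtain ⟨y, hy, z, hz, hxe⟩ := ih j x hx
    have hz' : z ∈ signedLocalPointsOfEmb κ ι W 1 (2 * (j + k)) := by rwa [show 2 * (j + k) = 2 * j + 2 * k by ring]
    obtain ⟨y', hy', z', hz', hze⟩ := plusLocOne_of_honda W κ ι hnt hidx hg d hd htr hgen hgen0 (j + k) z hz'
    have hlay : 2 * (j + k) + 2 = 2 * j + 2 * (k + 1) := by ring
    rw [hlay] at hy' hz'
    have hmono : signedLocalPointsOfEmb κ ι W 1 (2 * j + 2 * k) ≤ signedLocalPointsOfEmb κ ι W 1 (2 * j + 2 * (k + 1)) :=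
      signedLocalPointsOfEmb_mono κ ι W 1 (by omega)
    refine ⟨y + p ^ k • y', add_mem (hmono hy) (AddSubgroup.nsmul_mem _ hy' _), z', hz', ?_⟩
    rw [hxe, hze]
    simp only [smul_add, smul_sub, galois_smul_nsmul_modP W g, pow_succ, mul_smul]
    abel

/-- **COINV⁺ in pair form** (the `⁺` twin of `SSFlatEC.flatAnnihilator_twist_divisible`): under the Honda package, for every
`x ∈ ⨆ₙ E⁺(K_n·K_v)` and `k` there are `x', m ∈ ⨆ₙ E⁺(K_n·K_v)` with `p^k·x − p^k·(g⁻¹x' − x') = p^{k+k}·m`, i.e.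
`x ⊗ p^{-k} = (g⁻¹ − 1)·(x' ⊗ p^{-k})` in `E(K_∞·K_v) ⊗ ℚ_p/ℤ_p`: the `Γ`-coinvariants of `(⋃E⁺_n) ⊗ ℚ_p/ℤ_p` vanish.
[cite: Kobayashi2003, Thm. 6.2, Prop. 8.23] [cite: BDKim2013, Props. 2.2–2.3] -/
theorem plusCoinvPair_of_honda
    (hnt : ∀ P ∈ localTowerPointsOfEmb κ ι W, p • P = 0 → P = 0)
    (hidx : ∀ m : ℕ, ((localLayerSubgroupOfEmb κ ι (m + 1)).subgroupOf (localLayerSubgroupOfEmb κ ι m)).index = p)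
    {g : Field.absoluteGaloisGroup E} (hg : κ.IsTopGenerator (resGalOfEmb ι g))
    (d : ℕ → localPoints W E) (hd : ∀ m, d m ∈ localLayerPointsOfEmb κ ι W m)
    (htr : ∀ m, localTraceOfEmb κ ι W (m + 1) (m + 2) (d (m + 2)) = -d m)
    (hgen : ∀ m : ℕ, 1 ≤ m → ∀ P ∈ localLayerPointsOfEmb κ ι W m,
      ∃ B ∈ AddSubgroup.closure (Set.range fun σ : Field.absoluteGaloisGroup E ↦ σ • d m),
        ∃ P' ∈ localLayerPointsOfEmb κ ι W (m - 1), ∃ R ∈ localLayerPointsOfEmb κ ι W m, P = B + P' + p • R)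
    (hgen0 : ∀ P ∈ localLayerPointsOfEmb κ ι W 0, ∃ a : ℤ, ∃ R ∈ localLayerPointsOfEmb κ ι W 0, P = a • d 0 + p • R) :
    ∀ x ∈ (⨆ n, signedLocalPointsOfEmb κ ι W 1 n), ∀ k : ℕ,
      ∃ x' ∈ (⨆ n, signedLocalPointsOfEmb κ ι W 1 n), ∃ m ∈ (⨆ n, signedLocalPointsOfEmb κ ι W 1 n),
        p ^ k • x - p ^ k • (g⁻¹ • x' - x') = p ^ (k + k) • m := by
  intro x hx k
  obtain ⟨n, hxn⟩ := (AddSubgroup.mem_iSup_of_directed (signedLocalPointsOfEmb_mono κ ι W 1).directed_le).1 hx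
  have hx2n : x ∈ signedLocalPointsOfEmb κ ι W 1 (2 * n) := signedLocalPointsOfEmb_mono κ ι W 1 (by omega) hxn
  obtain ⟨y, hy, z, hz, hxe⟩ := plusDiv_of_honda W κ ι hnt hidx hg d hd htr hgen hgen0 k n x hx2n
  have hle : signedLocalPointsOfEmb κ ι W 1 (2 * n + 2 * k) ≤ ⨆ m, signedLocalPointsOfEmb κ ι W 1 m :=
    le_iSup (fun m ↦ signedLocalPointsOfEmb κ ι W 1 m) (2 * n + 2 * k)
  have hstab : g • y ∈ signedLocalPointsOfEmb κ ι W 1 (2 * n + 2 * k) := by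
    have hy' := hy
    rw [signedLocalPointsOfEmb_eq_towerSigned] at hy' ⊢
    exact smul_mem_towerSignedLocalPointsOfEmb κ.layerSubgroup ι W 1 _ g hy'
  refine ⟨-(g • y), hle (AddSubgroup.neg_mem _ hstab), z, hle hz, ?_⟩
  rw [smul_neg, inv_smul_smul, hxe, pow_add, mul_smul]
  simp only [smul_add, smul_sub, smul_neg, sub_neg_eq_add]
  abel

end General

/-! ## §3 `K = ℚ`, `p = 2`: COINV⁺@2 in pair form ⟸ HONDA⁺@2 -/

section Two

open NumberField IsDedekindDomain

variable (W : WeierstrassCurve ℚ) [W.IsElliptic] [W.IsGloballyMinimal]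

/-- **COINV⁺@2 in pair form from a plus Honda system at `2`** (cyclotomic `κ`, `v ∋ 2`, `g` a local lift of the topological
generator — `ZpExtension.IsCyclotomic.exists_isTopGenerator_resGalOfEmb_adicCompletion`): (NT) and (IDX) are theorems at a good
supersingular `2`; the module-level input of the LOC⁺@2 lift (the `⁺` twin of `SSFlatEC.exists_localLift_flat`).
[cite: Kobayashi2003, Thm. 6.2, Prop. 8.23, §8.4] [cite: BDKim2013, Props. 2.2–2.3] [cite: Sprung2012, Thm. 2.2, Lemma 2.3] -/
theorem plusCoinvPair_two_of_honda (hss : Rank1Residual.GoodSS W 2) {κ : ZpExtension ℚ 2} (hκ : κ.IsCyclotomic)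
    (v : HeightOneSpectrum (𝓞 ℚ)) (hv : (2 : 𝓞 ℚ) ∈ v.asIdeal)
    {g : Field.absoluteGaloisGroup (v.adicCompletion ℚ)}
    (hg : κ.IsTopGenerator (resGalOfEmb (closureEmb (K := ℚ) (v.adicCompletion ℚ)) g))
    (d : ℕ → localPoints W (v.adicCompletion ℚ))
    (hd : ∀ m, d m ∈ localLayerPointsOfEmb κ (closureEmb (K := ℚ) (v.adicCompletion ℚ)) W m)
    (htr : ∀ m, localTraceOfEmb κ (closureEmb (K := ℚ) (v.adicCompletion ℚ)) W (m + 1) (m + 2) (d (m + 2)) = -d m)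
    (hgen : ∀ m : ℕ, 1 ≤ m → ∀ P ∈ localLayerPointsOfEmb κ (closureEmb (K := ℚ) (v.adicCompletion ℚ)) W m,
      ∃ B ∈ AddSubgroup.closure (Set.range fun σ : Field.absoluteGaloisGroup (v.adicCompletion ℚ) ↦ σ • d m),
        ∃ P' ∈ localLayerPointsOfEmb κ (closureEmb (K := ℚ) (v.adicCompletion ℚ)) W (m - 1),
        ∃ R ∈ localLayerPointsOfEmb κ (closureEmb (K := ℚ) (v.adicCompletion ℚ)) W m, P = B + P' + 2 • R)
    (hgen0 : ∀ P ∈ localLayerPointsOfEmb κ (closureEmb (K := ℚ) (v.adicCompletion ℚ)) W 0,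
      ∃ a : ℤ, ∃ R ∈ localLayerPointsOfEmb κ (closureEmb (K := ℚ) (v.adicCompletion ℚ)) W 0, P = a • d 0 + 2 • R) :
    ∀ x ∈ (⨆ n, signedLocalPoints κ (v.adicCompletion ℚ) W 1 n), ∀ k : ℕ,
      ∃ x' ∈ (⨆ n, signedLocalPoints κ (v.adicCompletion ℚ) W 1 n),
        ∃ m ∈ (⨆ n, signedLocalPoints κ (v.adicCompletion ℚ) W 1 n),
          2 ^ k • x - 2 ^ k • (g⁻¹ • x' - x') = 2 ^ (k + k) • m := by
  have hnt : ∀ P ∈ localTowerPointsOfEmb κ (closureEmb (K := ℚ) (v.adicCompletion ℚ)) W, 2 • P = 0 → P = 0 :=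
    fun P hP h2 ↦ SSFlatEC.eq_zero_of_mem_localTowerPointsOfEmb_of_two_nsmul W hss κ (by exact_mod_cast hv) _ hP h2
  have hidx := index_subgroupOf_localLayerSubgroupOfEmb_succ_eq (p := 2) hκ v (by exact_mod_cast hv)
  exact plusCoinvPair_of_honda W κ (closureEmb (K := ℚ) (v.adicCompletion ℚ)) hnt hidx hg d hd htr hgen hgen0

end Two

end Summit.BirchSwinnertonDyer.BirchSwinnertonDyer.Theorems.SignedEC

end
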